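import Literature.AnabelianGeometry.SemiGraphs.PSCUnrVerticialLevelwiseProofs
import Literature.AnabelianGeometry.SemiGraphs.PSCEdgewiseCriterionProofs
import Literature.AnabelianGeometry.SemiGraphs.PSCGraphicitySub
import Literature.AnabelianGeometry.SemiGraphs.ProSigmaCompletionHomCount
import Mathlib.Topology.Algebra.ClopenNhdofOne
import HarnessLib

/-!
# [CombGC] Theorem 1.6 (iii): a verticially filtration-preserving `β` preserves verticially purely totally ramified coverings

Mochizuki, *Inter-universal Teichmüller theory I*, Remark 1.2.3 (vii), kurims manuscript p. 43:
necessity in [CombGC] Theorem 1.6 (iii) "follows formally from the characterization of unramified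
verticial subgroups given in Remark 1.4.3 and the characterization of verticially purely totally
ramified finite étale coverings given in Remark 1.4.2"; Remark 1.2.3 (iii), p. 41 (= [CombGC] Rmk.
1.4.2, second and third displays): for a Galois `Π^unr_G`-covering `G' → G` of degree a positive power
of `l` [so `n(G') = n(G) · deg(G'/G)`], "`G' → G` is verticially purely totally ramified if and only
if `i(G') = deg(G'/G) · (i(G) − 1) + 1`", equivalently "`i(G') − n(G') = deg(G'/G)·(i(G) − n(G) − 1)
+ 1`"; and [CombGC] Remark 1.1.3, p. 8: "`Π^grph_G` is a … free pro-`Σ` group of rank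
`n(G) − i(G) + 1`", i.e. `M_G / M^vert_G` is free of that rank over `Ẑ^Σ` (Rmk. 1.1.4).
[cite: Mochizuki2012, IUTchI Rmk 1.2.3(vii) p.43] [cite: MochizukiCombGC2007, Rmk 1.4.2 p.11]

Together these make "verticially purely totally ramified" a function of the verticial FILTRATION:
`ρ(G') = deg · ρ(G)` with `ρ := n + 1 − i = rank(M/M^vert)`, which a verticially filtration-preserving
`β : Π^unr_G ⥲ Π^unr_H` (Def. 1.4 (iii)) transports.  This proof-only file (row T16-L16a of the cell's
sub-DAG for Theorem 1.6 = item (N2) of abc-iut-w5-d174's decomposition of the necessity kernel) PROVES: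

* `nonempty_continuousMulEquiv_subquotient` — for a level `U ⊇ Ker` and a closed `V ⊇ Ker` with
  `[U, U] ⊆ V`, the transport along `β` induces a topological isomorphism `U / V ≃ β(U) / β(V)`;
* `grphRank_eq_unrTransport` — granted Rmk. 1.1.3's rank statement `AbelianizedGrphRank` for `G`, `H`
  (abc-iut-w4-d052, row T16-L15): `n(G_U) + 1 − i(G_U) = n(H_{βU}) + 1 − i(H_{βU})` at every level;
* `isVerticiallyPurelyTotallyRamified_unrTransport_iff` — **(N2)**: granted in addition Rmk. 1.4.2's
  count criterion `VerticialPureRamificationCount` for `G`, `H` (abc-iut-L3-t4) and the connectivity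
  bound `i ≤ n + 1` of the coverings' graphs (displayed hypothesis: Rmk. 1.1.3's rank `n − i + 1` is a
  natural number; the interface does not record connectedness), `G_U → G` (`U` open normal of index
  `l^k`, `k > 0`) is verticially purely totally ramified iff the covering attached to `β(U)` is.
Inputs enter BY NAME; proof-only (0 defs); nothing here takes a side on [IUTchIII] Cor. 3.12.
-/

noncomputable section

namespace Literature.AnabelianGeometry.SemiGraphs

namespace PSCDatum

open scoped Pointwise
open SemiGraphOfAnabelioids (IsProSigmaCompletion)

universe u

/-! ### 1. Topological-group plumbing -/

section Plumbing

variable {A : Type u} [Group A] [TopologicalSpace A] [IsTopologicalGroup A]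

omit [TopologicalSpace A] [IsTopologicalGroup A] in
/-- `V ∩ U` is normal in `U` as soon as `[U, U] ⊆ V`. [folklore] -/
private theorem normal_subgroupOf_of_commutator_le {U V : Subgroup A} (h : ⁅U, U⁆ ≤ V) :
    (V.subgroupOf U).Normal := by
  refine ⟨fun n hn g => ?_⟩
  rw [Subgroup.mem_subgroupOf] at hn ⊢
  have hc : (g : A) * n * (g : A)⁻¹ * (n : A)⁻¹ ∈ V :=
    h (Subgroup.commutator_mem_commutator g.2 n.2)
  simpa using V.mul_mem hc hn

/-- The quotient of a compact totally disconnected group by a CLOSED normal subgroup is totally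
disconnected; private copy of `QuotientGroup.totallyDisconnectedSpace_of_isClosed`
(AbsoluteAnabelian/LocalReciprocityCofinal.lean, whose imports are not wanted here). [folklore] -/
private theorem totallyDisconnectedSpace_quotient [CompactSpace A] [TotallyDisconnectedSpace A]
    (N : Subgroup A) [N.Normal] (hN : IsClosed (N : Set A)) : TotallyDisconnectedSpace (A ⧸ N) := by
  haveI : TotallySeparatedSpace (A ⧸ N) := by
    rw [totallySeparatedSpace_iff_exists_isClopen]
    intro x y hxy
    obtain ⟨g, rfl⟩ := QuotientGroup.mk_surjective x
    obtain ⟨g', rfl⟩ := QuotientGroup.mk_surjective y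
    set h : A := g⁻¹ * g' with hh
    have hhN : h ∉ N := fun hmem => hxy (QuotientGroup.eq.mpr hmem)
    let O : Set A := (fun k : A => k * h) ⁻¹' (N : Set A)ᶜ
    have hO : IsOpen O := hN.isOpen_compl.preimage (continuous_id.mul continuous_const)
    have h1O : (1 : A) ∈ O := by
      change 1 * h ∈ (N : Set A)ᶜ
      rw [one_mul]; exact hhN
    obtain ⟨K, hK⟩ := ProfiniteGrp.exist_openNormalSubgroup_sub_open_nhds_of_one hO h1O
    let S : Subgroup A := K.toSubgroup ⊔ N
    have hSopen : IsOpen (S : Set A) := Subgroup.isOpen_mono le_sup_left K.isOpen'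
    have hSclosed : IsClosed (S : Set A) := Subgroup.isClosed_of_isOpen _ hSopen
    refine ⟨QuotientGroup.mk '' (g • (S : Set A)), ⟨?_, ?_⟩, ?_, ?_⟩
    · exact QuotientGroup.isClosedMap_coe hN.isCompact _ (hSclosed.smul g)
    · exact QuotientGroup.isOpenMap_coe _ (hSopen.smul g)
    · exact ⟨g, ⟨1, S.one_mem, by simp⟩, rfl⟩
    · rintro ⟨s, ⟨t, ht, rfl⟩, hs⟩
      have hmem : (g • t)⁻¹ * g' ∈ N := QuotientGroup.eq.mp hs
      have ht' : h ∈ (S : Set A) := by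
        have h2 : h = t * ((g • t)⁻¹ * g') := by
          rw [hh, smul_eq_mul, mul_inv_rev]; group
        rw [h2]
        exact S.mul_mem ht (Subgroup.mem_sup_right hmem)
      rw [Subgroup.mul_normal] at ht'
      obtain ⟨k, hk, n, hn, hkn⟩ := ht'
      have hk' : k⁻¹ ∈ O := hK (K.toSubgroup.inv_mem hk)
      apply hk'
      change k⁻¹ * h ∈ (N : Set A)
      rw [← hkn, inv_mul_cancel_left]
      exact hn
  infer_instance

omit [IsTopologicalGroup A] in
/-- A continuous surjective homomorphism from a compact group onto a Hausdorff group with kernel `N`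
induces a TOPOLOGICAL isomorphism `A ⧸ N ≃ₜ* Z` (first isomorphism theorem + compact-to-Hausdorff).
[folklore] -/
private theorem nonempty_continuousMulEquiv_of_surjective [CompactSpace A] {Z : Type u} [Group Z]
    [TopologicalSpace Z] [T2Space Z] (f : A →* Z) (hf : Continuous f)
    (hsurj : Function.Surjective f) (N : Subgroup A) [N.Normal] (hN : f.ker = N) :
    Nonempty (A ⧸ N ≃ₜ* Z) := by
  let e : A ⧸ N ≃* Z :=
    (QuotientGroup.quotientMulEquivOfEq hN.symm).trans
      (QuotientGroup.quotientKerEquivOfSurjective f hsurj)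
  have he : ∀ a : A, e (QuotientGroup.mk a) = f a := fun a => by
    simp only [e, MulEquiv.trans_apply, QuotientGroup.quotientMulEquivOfEq_mk,
      QuotientGroup.quotientKerEquivOfSurjective, QuotientGroup.quotientKerEquivOfRightInverse_apply,
      QuotientGroup.kerLift_mk]
  have hcont : Continuous e := by
    rw [(QuotientGroup.isQuotientMap_mk N).continuous_iff]
    have : (e : A ⧸ N → Z) ∘ QuotientGroup.mk = f := funext he
    rw [this]; exact hf
  let h : A ⧸ N ≃ₜ Z := hcont.homeoOfEquivCompactToT2 (f := e.toEquiv)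
  exact ⟨{ e with continuous_toFun := hcont, continuous_invFun := h.continuous_symm }⟩

/-- An open subgroup of a compact group is compact. [folklore] -/
private theorem compactSpace_of_isOpen [CompactSpace A] {U : Subgroup A} (hU : IsOpen (U : Set A)) :
    CompactSpace U :=
  isCompact_iff_compactSpace.mp (Subgroup.isClosed_of_isOpen U hU).isCompact

end Plumbing

/-! ### 2. The transport along `β` on levels: top, index, commutators -/

section Transport

variable {P : Type u} [Group P] [TopologicalSpace P] [IsTopologicalGroup P]
variable {P' : Type u} [Group P'] [TopologicalSpace P'] [IsTopologicalGroup P']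
variable (G : PSCDatum P) (H : PSCDatum P') (β : (P ⧸ G.unrKer) ≃ₜ* (P' ⧸ H.unrKer))

omit [IsTopologicalGroup P'] in
/-- `[U, U] ⊆` the inverse image of `M^vert_{G_U}` (it contains `\overline{[U,U]}` by definition).
[cite: MochizukiCombGC2007, Def 1.1(ii) p.7] -/
theorem commutator_le_vertFil (U : Subgroup P) : ⁅U, U⁆ ≤ G.vertFil U :=
  le_sup_left.trans (Subgroup.le_topologicalClosure _)

omit [IsTopologicalGroup P'] in
/-- The inverse image of `M^vert_{G_U}` is closed. [cite: MochizukiCombGC2007, Def 1.1(ii) p.7] -/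
theorem isClosed_vertFil (U : Subgroup P) : IsClosed (G.vertFil U : Set P) := by
  unfold vertFil
  exact Subgroup.isClosed_topologicalClosure _

/-- The transport of the trivial covering is the trivial covering. [cite: MochizukiCombGC2007, Def 1.4(iii) p.10] -/
theorem unrTransport_top : G.unrTransport H β ⊤ = ⊤ := by
  unfold unrTransport
  rw [← MonoidHom.range_eq_map, MonoidHom.range_eq_top.mpr (QuotientGroup.mk'_surjective _),
    ← MonoidHom.range_eq_map, MonoidHom.range_eq_top.mpr β.toMulEquiv.surjective, Subgroup.comap_top]

/-- The transport preserves the index of levels: `[Π_H : β(U)] = [Π_G : U]` for `U ⊇ Ker`.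
[cite: MochizukiCombGC2007, Def 1.4(iii) p.10] -/
theorem index_unrTransport {U : Subgroup P} (hKU : G.unrKer ≤ U) :
    (G.unrTransport H β U).index = U.index := by
  unfold unrTransport
  rw [Subgroup.index_comap_of_surjective _ (QuotientGroup.mk'_surjective _),
    MulEquiv.toMonoidHom_eq_coe, Subgroup.index_map_equiv,
    Subgroup.index_map_eq _ (QuotientGroup.mk'_surjective _) (by rwa [QuotientGroup.ker_mk'])]

/-- The transport respects commutator inclusions: `[U, U] ⊆ V ⇒ [β(U), β(U)] ⊆ β(V)`.
[cite: MochizukiCombGC2007, Def 1.4(iii) p.10] -/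
theorem commutator_unrTransport_le {U V : Subgroup P} (h : ⁅U, U⁆ ≤ V) :
    ⁅G.unrTransport H β U, G.unrTransport H β U⁆ ≤ G.unrTransport H β V := by
  rw [Subgroup.commutator_le]
  intro x hx y hy
  rw [mem_unrTransport_iff] at hx hy ⊢
  obtain ⟨s, hs, hsx⟩ := hx
  obtain ⟨t, ht, hty⟩ := hy
  refine ⟨s * t * s⁻¹ * t⁻¹, h (Subgroup.commutator_mem_commutator hs ht), ?_⟩
  simp only [commutatorElement_def, QuotientGroup.mk_mul, QuotientGroup.mk_inv, map_mul, map_inv,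
    hsx, hty]

end Transport

/-! ### 3. The induced topological isomorphism `U / V ≃ β(U) / β(V)` -/

section Subquotient

variable {P : Type u} [Group P] [TopologicalSpace P] [IsTopologicalGroup P] [CompactSpace P]
variable {P' : Type u} [Group P'] [TopologicalSpace P'] [IsTopologicalGroup P'] [CompactSpace P']
variable (G : PSCDatum P) (H : PSCDatum P') (β : (P ⧸ G.unrKer) ≃ₜ* (P' ⧸ H.unrKer))

/-- **First-isomorphism plumbing for the transport.**  For a level `U ⊇ Ker(Π_G ↠ Π^unr_G)` (open)
and a closed `V` with `Ker ≤ V`, `[U, U] ⊆ V`, and `V' = β(V)` (the transport of `V`), the isomorphism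
`β` induces a topological isomorphism `U / (V ∩ U) ≃ β(U) / (V' ∩ β(U))`: both sides map onto the
Hausdorff group `Ū / V̄` inside `Π^unr_G` (`Ū`, `V̄` the images of `U`, `V`), with kernels `V ∩ U`,
`V' ∩ β(U)`. [cite: MochizukiCombGC2007, Def 1.4(iii) p.10] -/
theorem nonempty_continuousMulEquiv_subquotient {U V : Subgroup P} {V' : Subgroup P'}
    (hUo : IsOpen (U : Set P)) (hKV : G.unrKer ≤ V) (hVc : IsClosed (V : Set P)) (hVn : ⁅U, U⁆ ≤ V)
    (hV' : G.unrTransport H β V = V') [(V.subgroupOf U).Normal]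
    [(V'.subgroupOf (G.unrTransport H β U)).Normal] :
    Nonempty ((U ⧸ V.subgroupOf U) ≃ₜ*
      (↥(G.unrTransport H β U) ⧸ V'.subgroupOf (G.unrTransport H β U))) := by
  set π := QuotientGroup.mk' G.unrKer with hπ
  set Ubar : Subgroup (P ⧸ G.unrKer) := U.map π with hUbar
  set Vbar : Subgroup (P ⧸ G.unrKer) := V.map π with hVbar
  set W : Subgroup P' := G.unrTransport H β U with hW
  haveI hn : (Vbar.subgroupOf Ubar).Normal := by
    refine normal_subgroupOf_of_commutator_le ?_
    rw [hUbar, hVbar, ← Subgroup.map_commutator]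
    exact Subgroup.map_mono hVn
  have hVbar_c : IsClosed (Vbar : Set (P ⧸ G.unrKer)) := by
    rw [← (QuotientGroup.isQuotientMap_mk G.unrKer).isClosed_preimage]
    have : (QuotientGroup.mk : P → P ⧸ G.unrKer) ⁻¹' (Vbar : Set (P ⧸ G.unrKer)) = (V : Set P) := by
      rw [hVbar, ← QuotientGroup.coe_mk', ← Subgroup.coe_comap, Subgroup.comap_map_eq,
        QuotientGroup.ker_mk', sup_eq_left.mpr hKV]
    rw [this]; exact hVc
  haveI : IsClosed ((Vbar.subgroupOf Ubar : Subgroup Ubar) : Set Ubar) :=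
    hVbar_c.preimage continuous_subtype_val
  haveI : CompactSpace U := compactSpace_of_isOpen hUo
  haveI : CompactSpace W := compactSpace_of_isOpen (G.isOpen_unrTransport H β hUo)
  -- (a) from `U`: `u ↦ [π u]`
  let f₁ : U →* Ubar ⧸ Vbar.subgroupOf Ubar :=
    (QuotientGroup.mk' (Vbar.subgroupOf Ubar)).comp (π.subgroupMap U)
  have hf₁c : Continuous f₁ := by
    refine QuotientGroup.continuous_mk.comp (continuous_induced_rng.mpr ?_)
    exact QuotientGroup.continuous_mk.comp continuous_subtype_val
  have hf₁s : Function.Surjective f₁ :=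
    (QuotientGroup.mk'_surjective _).comp (π.subgroupMap_surjective U)
  have hf₁k : f₁.ker = V.subgroupOf U := by
    ext u
    rw [MonoidHom.mem_ker, MonoidHom.comp_apply, QuotientGroup.mk'_apply, QuotientGroup.eq_one_iff,
      Subgroup.mem_subgroupOf, Subgroup.mem_subgroupOf, MonoidHom.subgroupMap_apply_coe]
    change π (u : P) ∈ Vbar ↔ (u : P) ∈ V
    rw [← Subgroup.mem_comap, hVbar, Subgroup.comap_map_eq, QuotientGroup.ker_mk',
      sup_eq_left.mpr hKV]
  obtain ⟨e₁⟩ := nonempty_continuousMulEquiv_of_surjective f₁ hf₁c hf₁s (V.subgroupOf U) hf₁k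
  -- (b) from `W = β(U)`: `w ↦ [β⁻¹ (π_H w)]`
  have hmemU : ∀ w : W, β.symm (QuotientGroup.mk' H.unrKer (w : P')) ∈ Ubar := by
    intro w
    obtain ⟨s, hs, hsw⟩ := (G.mem_unrTransport_iff H β).mp w.2
    rw [QuotientGroup.mk'_apply, ← hsw, ContinuousMulEquiv.symm_apply_apply]
    exact ⟨s, hs, rfl⟩
  let g₀ : W →* Ubar :=
    (β.symm.toMulEquiv.toMonoidHom.comp ((QuotientGroup.mk' H.unrKer).comp W.subtype)).codRestrict
      Ubar hmemU
  let f₂ : W →* Ubar ⧸ Vbar.subgroupOf Ubar := (QuotientGroup.mk' (Vbar.subgroupOf Ubar)).comp g₀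
  have hf₂c : Continuous f₂ := by
    refine QuotientGroup.continuous_mk.comp (continuous_induced_rng.mpr ?_)
    exact β.symm.continuous.comp (QuotientGroup.continuous_mk.comp continuous_subtype_val)
  have hf₂s : Function.Surjective f₂ := by
    refine (QuotientGroup.mk'_surjective _).comp fun x => ?_
    obtain ⟨s, hs, hsx⟩ := x.2
    obtain ⟨w, hw⟩ := QuotientGroup.mk_surjective (β (π s))
    have hwW : w ∈ W := (G.mem_unrTransport_iff H β).mpr ⟨s, hs, hw.symm⟩
    refine ⟨⟨w, hwW⟩, Subtype.ext ?_⟩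
    change β.symm (QuotientGroup.mk' H.unrKer w) = (x : P ⧸ G.unrKer)
    rw [QuotientGroup.mk'_apply, hw, ContinuousMulEquiv.symm_apply_apply, hsx]
  have hf₂k : f₂.ker = V'.subgroupOf W := by
    ext w
    rw [MonoidHom.mem_ker, MonoidHom.comp_apply, QuotientGroup.mk'_apply, QuotientGroup.eq_one_iff,
      Subgroup.mem_subgroupOf, Subgroup.mem_subgroupOf]
    change β.symm (QuotientGroup.mk' H.unrKer (w : P')) ∈ Vbar ↔ (w : P') ∈ V'
    rw [← hV', G.mem_unrTransport_iff H β, hVbar, Subgroup.mem_map]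
    constructor
    · rintro ⟨s, hs, hsw⟩
      refine ⟨s, hs, ?_⟩
      have h1 := congrArg β hsw
      rw [ContinuousMulEquiv.apply_symm_apply] at h1
      exact h1
    · rintro ⟨s, hs, hsw⟩
      refine ⟨s, hs, ?_⟩
      have h1 := congrArg β.symm hsw
      rw [ContinuousMulEquiv.symm_apply_apply] at h1
      exact h1
  obtain ⟨e₂⟩ := nonempty_continuousMulEquiv_of_surjective f₂ hf₂c hf₂s (V'.subgroupOf W) hf₂k
  exact ⟨e₁.trans e₂.symm⟩

end Subquotient

/-! ### 4. Ranks of `M/M^vert` along `β`, and (N2) -/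

section N2

variable {P : Type u} [Group P] [TopologicalSpace P] [IsTopologicalGroup P] [CompactSpace P]
  [TotallyDisconnectedSpace P]
variable {P' : Type u} [Group P'] [TopologicalSpace P'] [IsTopologicalGroup P'] [CompactSpace P']
  [TotallyDisconnectedSpace P']
variable (G : PSCDatum P) (H : PSCDatum P') (β : (P ⧸ G.unrKer) ≃ₜ* (P' ⧸ H.unrKer))

/-- **`rank(M_{G_U}/M^vert_{G_U}) = rank(M_{H_{β U}}/M^vert_{H_{β U}})`** for a verticially
filtration-preserving `β` and every level `U ⊇ Ker` — granted [CombGC] Rmk. 1.1.3's rank statement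
(`AbelianizedGrphRank`, row T16-L15) for `G` and `H`: the transport induces `U/vertFil U ≃ₜ*
β(U)/vertFil β(U)` (`nonempty_continuousMulEquiv_subquotient` with `β(vertFil U) = vertFil β(U)`), and
the rank of a pro-`Σ` completion of `ℤ^r` is a topological invariant (`rank_eq_of_continuousMulEquiv`).
[cite: MochizukiCombGC2007, Rmk 1.1.3 p.8] -/
theorem grphRank_eq_unrTransport {l : ℕ} (hS : G.Sigma = {l}) (hS' : H.Sigma = {l})
    (hrG : G.AbelianizedGrphRank) (hrH : H.AbelianizedGrphRank)
    (hβ : G.IsUnrVerticiallyFiltrationPreserving H β)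
    {U : Subgroup P} (hUo : IsOpen (U : Set P)) (hKU : G.unrKer ≤ U) :
    G.nodeCount U + 1 - G.vertCount U =
      H.nodeCount (G.unrTransport H β U) + 1 - H.vertCount (G.unrTransport H β U) := by
  set W := G.unrTransport H β U with hW
  have hWo : IsOpen (W : Set P') := G.isOpen_unrTransport H β hUo
  have hVW : G.unrTransport H β (G.vertFil U) = H.vertFil W := hβ U hUo hKU
  haveI : ((G.vertFil U).subgroupOf U).Normal :=
    normal_subgroupOf_of_commutator_le (G.commutator_le_vertFil U)
  haveI : ((H.vertFil W).subgroupOf W).Normal :=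
    normal_subgroupOf_of_commutator_le (H.commutator_le_vertFil W)
  obtain ⟨ι, hι⟩ := hrG U hUo
  obtain ⟨ι', hι'⟩ := hrH W hWo
  obtain ⟨e⟩ := G.nonempty_continuousMulEquiv_subquotient H β hUo (G.unrKer_le_vertFil hKU)
    (G.isClosed_vertFil U) (G.commutator_le_vertFil U) hVW
  haveI : CompactSpace U := compactSpace_of_isOpen hUo
  haveI : CompactSpace W := compactSpace_of_isOpen hWo
  haveI : TotallyDisconnectedSpace (U ⧸ (G.vertFil U).subgroupOf U) :=
    totallyDisconnectedSpace_quotient _ ((G.isClosed_vertFil U).preimage continuous_subtype_val)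
  haveI : TotallyDisconnectedSpace (W ⧸ (H.vertFil W).subgroupOf W) :=
    totallyDisconnectedSpace_quotient _ ((H.isClosed_vertFil W).preimage continuous_subtype_val)
  have hl : l.Prime := G.sigma_prime l (by rw [hS]; exact Set.mem_singleton l)
  rw [hS] at hι
  rw [hS'] at hι'
  exact SemiGraphOfAnabelioids.IsProSigmaCompletion.rank_eq_of_continuousMulEquiv hι hι' hl
    (Set.mem_singleton l) e

omit [TopologicalSpace P] [IsTopologicalGroup P] [CompactSpace P] [TotallyDisconnectedSpace P]
  [TopologicalSpace P'] [IsTopologicalGroup P'] [CompactSpace P'] [TotallyDisconnectedSpace P'] in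
/-- The arithmetic of [CombGC] Rmk. 1.4.2 / [IUTchI] Rmk. 1.2.3 (iii), third display: with
`n₁ = deg · n₀` and `i ≤ n + 1` on both levels, "`i₁ = deg · (i₀ − 1) + 1`" is equivalent to
"`n₁ + 1 − i₁ = deg · (n₀ + 1 − i₀)`" (`rank(M₁/M₁^vert) = deg · rank(M₀/M₀^vert)`).
[cite: MochizukiCombGC2007, Rmk 1.4.2 p.11] -/
theorem vertCount_eq_iff_rank_eq {d n₀ i₀ n₁ i₁ : ℕ} (hn : n₁ = n₀ * d) (hi₀ : i₀ ≤ n₀ + 1)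
    (hi₁ : i₁ ≤ n₁ + 1) :
    ((i₁ : ℤ) = (d : ℤ) * ((i₀ : ℤ) - 1) + 1) ↔ n₁ + 1 - i₁ = d * (n₀ + 1 - i₀) := by
  obtain ⟨a, ha⟩ := Nat.exists_eq_add_of_le hi₀
  obtain ⟨b, hb⟩ := Nat.exists_eq_add_of_le hi₁
  rw [ha, hb, Nat.add_sub_cancel_left, Nat.add_sub_cancel_left]
  have ha' : ((n₀ : ℤ) + 1) = i₀ + a := by exact_mod_cast ha
  have hb' : ((n₁ : ℤ) + 1) = i₁ + b := by exact_mod_cast hb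
  have hn' : (n₁ : ℤ) = n₀ * d := by exact_mod_cast hn
  constructor
  · intro h
    have : (b : ℤ) = d * a := by linear_combination -hb' - h + hn' + (d : ℤ) * ha'
    exact_mod_cast this
  · intro h
    have h' : (b : ℤ) = d * a := by exact_mod_cast h
    linear_combination -hb' - h' + hn' + (d : ℤ) * ha'

/-- **(N2) — [IUTchI] Rmk. 1.2.3 (iii)/(vii), [CombGC] Rmk. 1.4.2 in filtration form: a verticially
filtration-preserving `β : Π^unr_G ⥲ Π^unr_H` PRESERVES verticially purely totally ramified coverings.**
For profinite `Π_G`, `Π_H` of pro-`Σ` type with `Σ = {l}`, ANY topological isomorphism `β` of the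
unramified quotients that is verticially filtration-preserving (Def. 1.4 (iii) for `β`), and every
open normal `U ⊇ Ker(Π_G ↠ Π^unr_G)` of index `l^k`, `k > 0`: `G_U → G` is verticially purely totally
ramified iff `H_{β(U)} → H` is — granted, BY NAME for `G` and `H`, Rmk. 1.4.2's count criterion
(`VerticialPureRamificationCount`, abc-iut-L3-t4), Rmk. 1.1.3's rank of `M/M^vert`
(`AbelianizedGrphRank`, abc-iut-w4-d052) and the connectivity bound `i ≤ n + 1` for the graphs of
`Π^unr`-coverings (displayed).  Route: `vptr ⟺ i(U) = d·(i(⊤) − 1) + 1 ⟺ ρ(U) = d·ρ(⊤)` with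
`ρ = n + 1 − i` and `n(U) = d·n(⊤)`; `ρ`, `d` are `β`-invariant (`grphRank_eq_unrTransport`,
`index_unrTransport`). [cite: Mochizuki2012, IUTchI Rmk 1.2.3(vii) p.43] -/
theorem isVerticiallyPurelyTotallyRamified_unrTransport_iff {l : ℕ} (hS : G.Sigma = {l})
    (hS' : H.Sigma = {l}) (hβ : G.IsUnrVerticiallyFiltrationPreserving H β)
    (hcG : G.VerticialPureRamificationCount) (hcH : H.VerticialPureRamificationCount)
    (hrG : G.AbelianizedGrphRank) (hrH : H.AbelianizedGrphRank)
    (hiG : ∀ U : Subgroup P, IsOpen (U : Set P) → G.unrKer ≤ U → G.vertCount U ≤ G.nodeCount U + 1)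
    (hiH : ∀ U' : Subgroup P', IsOpen (U' : Set P') → H.unrKer ≤ U' →
      H.vertCount U' ≤ H.nodeCount U' + 1)
    {U : Subgroup P} (hUn : U.Normal) (hUo : IsOpen (U : Set P)) (hKU : G.unrKer ≤ U)
    {k : ℕ} (hk : 0 < k) (hidx : U.index = l ^ k) :
    G.IsVerticiallyPurelyTotallyRamified ⊤ U ↔
      H.IsVerticiallyPurelyTotallyRamified ⊤ (G.unrTransport H β U) := by
  set W := G.unrTransport H β U with hW
  obtain ⟨hWn, hWo, hKW⟩ := G.level_unrTransport H β hUn hUo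
  have hWidx : W.index = l ^ k := by rw [hW, G.index_unrTransport H β hKU, hidx]
  haveI := hUn
  haveI := hWn
  obtain ⟨hnG, hiffG⟩ := hcG l k U hS hk hUn hUo hidx hKU
  obtain ⟨hnH, hiffH⟩ := hcH l k W hS' hk hWn hWo hWidx hKW
  -- `β`-invariance of `ρ = n + 1 − i` at the level `U` and at the trivial level
  have hρU := G.grphRank_eq_unrTransport H β hS hS' hrG hrH hβ hUo hKU
  have hρtop := G.grphRank_eq_unrTransport H β hS hS' hrG hrH hβ (U := ⊤) (by simp) le_top
  rw [G.unrTransport_top H β, G.nodeCount_top, G.vertCount_top, H.nodeCount_top, H.vertCount_top]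
    at hρtop
  have hiU := hiG U hUo hKU
  have hitop := hiG ⊤ (by simp) le_top
  rw [G.nodeCount_top, G.vertCount_top] at hitop
  have hiW := hiH W hWo hKW
  have hitop' := hiH ⊤ (by simp) le_top
  rw [H.nodeCount_top, H.vertCount_top] at hitop'
  rw [hiffG, hiffH, vertCount_eq_iff_rank_eq hnG hitop hiU, vertCount_eq_iff_rank_eq hnH hitop' hiW,
    hρU, hρtop, ← hW, hWidx, hidx]

end N2

end PSCDatum

end Literature.AnabelianGeometry.SemiGraphs

end
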